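import Summits.RiemannHypothesis.RiemannHypothesis.Theorems.WeilFormatCDataRungGeneric
import HarnessLib

/-!
# Format C: the data front door with a COMPRESSED MIDDLE — exact columns + ANY certified middle matrix + ANY certified tail matrix ⟹ `WeilPositivityOn a`

Route context: Fourier–Galerkin / Schur-complement certificates of Weil positivity on a window ("format C";
cell memo `run/shared/lean/pub/rh-explicit/rh-explicit-weil-10/FORMATC-DESIGN.md` §9.10; supporting
stmt-RiemannHypothesis-0098; seat rh-explicit-weil-10).  This is `WeilFormatC.weilPositivityOn_of_formatC_kernels` (p331860) with
ONE more abstract piece per sector: between the exact columns `[B, B₃)` (weights `w ≤ d̂`) and the tail from `B₄` (matrix `U₂`,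
majorant premise `hU2` for every `d ≥ d₀` on `[B₄, ∞)`, `d₀ ≤ d̂(B₄)`) sits a MIDDLE range `[B₃, B₄)` with per-mode weights
`w' ≤ d̂` and an arbitrary matrix `U_mid` certified by the premise

  `hUmid : ∀ d, (∀ m ∈ [B₃, B₄), 0 < w' m ≤ d m) → ∀ x, Σ_{m∈Ico B₃ B₄} (Σ_i M(i,m)x_i)²/d m ≤ xᵀU_mid x`

— the conclusion shape of the compressed-middle theorems `even/odd_middleJ_majorant_matrix` (design "MJ": the structured
column decomposition is EXACT up to the order-`J` remainder, so the middle columns enter through a `(2J)×(2J)` Gram of exact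
mode values instead of `B·(B₄−B₃)` column boxes).  The kernel PSD check is stated against `M − U₁ − U_mid − U₂`.  With
`B₄ = B₃` (empty middle, `U_mid = 0`) this is the generic door again.

* `sum_Ico_le_sum_Ico_add_sum_Ico` — the range split for non-negative summands;
* `weilPositivityOn_of_formatC_pieces` — the door.

Standard axioms; no definitions; no RH claim (a rung `WeilPositivityOn a` is one case of
`riemannHypothesis_iff_forall_weilPositivityOn`).
-/

set_option autoImplicit false
-- `Summit.RiemannHypothesis.RiemannHypothesis.…` is the layout-mandated namespace (summit = problem name).
set_option linter.dupNamespace false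

noncomputable section

open Complex Finset Matrix
open scoped Real BigOperators ArithmeticFunction.vonMangoldt

namespace Summit.RiemannHypothesis.RiemannHypothesis.Theorems.WeilFormatC

open Literature.NumberTheory.LFunctions Literature.NumberTheory.LFunctions.Yoshida1992
open Literature.Analysis.SpecialFunctions

variable {a : ℝ}

/-! ## A range split for non-negative sums -/

section Split

/-- For `B₃ ≤ B₄` and a summand non-negative on `Ico B₃ N`: `Σ_{Ico B₃ N} f ≤ Σ_{Ico B₃ B₄} f + Σ_{Ico B₄ N} f`
(equality when `B₄ ≤ N`). -/
theorem sum_Ico_le_sum_Ico_add_sum_Ico {B₃ B₄ N : ℕ} (h34 : B₃ ≤ B₄) {f : ℕ → ℝ}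
    (hf : ∀ m, B₃ ≤ m → 0 ≤ f m) :
    ∑ m ∈ Finset.Ico B₃ N, f m ≤ ∑ m ∈ Finset.Ico B₃ B₄, f m + ∑ m ∈ Finset.Ico B₄ N, f m := by
  by_cases hN : N ≤ B₄
  · have h1 : ∑ m ∈ Finset.Ico B₃ N, f m ≤ ∑ m ∈ Finset.Ico B₃ B₄, f m :=
      Finset.sum_le_sum_of_subset_of_nonneg (Finset.Ico_subset_Ico_right hN) fun m hm _ ↦
        hf m (Finset.mem_Ico.mp hm).1
    have h2 : ∑ m ∈ Finset.Ico B₄ N, f m = 0 := by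
      rw [Finset.Ico_eq_empty (by omega), Finset.sum_empty]
    linarith
  · rw [Finset.sum_Ico_consecutive f h34 (not_le.mp hN).le]

end Split

/-! ## The data-only rung theorem -/

section Rung

/-- **Format C, data front door with a compressed middle.**  See the module docstring: per sector, exact columns on
`[B, B₃)` with weights `w`, an ARBITRARY middle matrix `U_mid` on `[B₃, B₄)` with per-mode weights `w'`, an ARBITRARY tail matrix
`U₂` from `B₄`, and the kernel PSD check against `M − U₁ − U_mid − U₂`; the conclusion is the rung `WeilPositivityOn a`. -/
theorem weilPositivityOn_of_formatC_pieces (ha : 0 < a)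
    -- EVEN sector data
    {Be B3e B4e : ℕ} (hBe : 2 ≤ Be) (hBBe : Be ≤ B3e) (hB34e : B3e ≤ B4e) {d0e : ℝ}
    (we wme : ℕ → ℝ)
    (h0e : 0 < ((reDigammaQuarter (freq a Be) - Real.log π) / 2 - a * (1 + weilArchDensity (2 * a)) / (π ^ 2 * Be ^ 2) - 1 / (8 * Be) - a * (1 + weilArchDensity (2 * a)) / π ^ 2 * Real.sqrt (8 / ((Be - 1 : ℕ) : ℝ)) - (∑ k ∈ weilPrimeIndex a, (Λ k : ℝ) / Real.sqrt k * (2 * Real.cos (π / (⌊2 * a / Real.log k⌋₊ + 2)))) / 2))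
    (hd0e : 0 < d0e ∧ d0e ≤ ((reDigammaQuarter (freq a B4e) - Real.log π) / 2 - a * (1 + weilArchDensity (2 * a)) / (π ^ 2 * B4e ^ 2) - 1 / (8 * B4e) - a * (1 + weilArchDensity (2 * a)) / π ^ 2 * Real.sqrt (8 / ((Be - 1 : ℕ) : ℝ)) - (∑ k ∈ weilPrimeIndex a, (Λ k : ℝ) / Real.sqrt k * (2 * Real.cos (π / (⌊2 * a / Real.log k⌋₊ + 2)))) / 2))
    (hwe : ∀ m, Be ≤ m → m < B3e → 0 < we m ∧ we m ≤ ((reDigammaQuarter (freq a m) - Real.log π) / 2 - a * (1 + weilArchDensity (2 * a)) / (π ^ 2 * m ^ 2) - 1 / (8 * m) - a * (1 + weilArchDensity (2 * a)) / π ^ 2 * Real.sqrt (8 / ((Be - 1 : ℕ) : ℝ)) - (∑ k ∈ weilPrimeIndex a, (Λ k : ℝ) / Real.sqrt k * (2 * Real.cos (π / (⌊2 * a / Real.log k⌋₊ + 2)))) / 2))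
    (hwme : ∀ m, B3e ≤ m → m < B4e → 0 < wme m ∧ wme m ≤ ((reDigammaQuarter (freq a m) - Real.log π) / 2 - a * (1 + weilArchDensity (2 * a)) / (π ^ 2 * m ^ 2) - 1 / (8 * m) - a * (1 + weilArchDensity (2 * a)) / π ^ 2 * Real.sqrt (8 / ((Be - 1 : ℕ) : ℝ)) - (∑ k ∈ weilPrimeIndex a, (Λ k : ℝ) / Real.sqrt k * (2 * Real.cos (π / (⌊2 * a / Real.log k⌋₊ + 2)))) / 2))
    (Umide : Matrix (Fin Be) (Fin Be) ℝ)
    (hUmide : ∀ d : ℕ → ℝ, (∀ m, B3e ≤ m → m < B4e → 0 < wme m ∧ wme m ≤ d m) → ∀ x : Fin Be → ℝ,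
      ∑ m ∈ Finset.Ico B3e B4e, (∑ i : Fin Be, (if (i : ℕ) = 0 then gramCoeff a 0 m else if m = 0 then gramCoeff a i 0 else (gramCoeff a i m + gramCoeff a i (-(m : ℤ))) / 2) * x i) ^ 2 / d m
        ≤ x ⬝ᵥ Umide *ᵥ x)
    (U2e : Matrix (Fin Be) (Fin Be) ℝ)
    (hU2e : ∀ d : ℕ → ℝ, (∀ m, B4e ≤ m → d0e ≤ d m) → ∀ (N : ℕ) (x : Fin Be → ℝ),
      ∑ m ∈ Finset.Ico B4e N, (∑ i : Fin Be, (if (i : ℕ) = 0 then gramCoeff a 0 m else if m = 0 then gramCoeff a i 0 else (gramCoeff a i m + gramCoeff a i (-(m : ℤ))) / 2) * x i) ^ 2 / d m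
        ≤ x ⬝ᵥ U2e *ᵥ x)
    (hSe : ∀ x : Fin Be → ℝ, 0 ≤ ∑ i, ∑ i', x i * x i' *
      ((if (i : ℕ) = 0 then gramCoeff a 0 i' else if (i' : ℕ) = 0 then gramCoeff a i 0 else (gramCoeff a i i' + gramCoeff a i (-(i' : ℤ))) / 2)
        - (∑ m ∈ Finset.Ico Be B3e, (if (i : ℕ) = 0 then gramCoeff a 0 m else if m = 0 then gramCoeff a i 0 else (gramCoeff a i m + gramCoeff a i (-(m : ℤ))) / 2) * (if (i' : ℕ) = 0 then gramCoeff a 0 m else if m = 0 then gramCoeff a i' 0 else (gramCoeff a i' m + gramCoeff a i' (-(m : ℤ))) / 2) / we m)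
        - Umide i i' - U2e i i'))
    -- ODD sector data
    {Bo B3o B4o : ℕ} (hBo : 1 ≤ Bo) (hBBo : Bo ≤ B3o) (hB34o : B3o ≤ B4o) {d0o : ℝ}
    (wo wmo : ℕ → ℝ)
    (h0o : 0 < ((reDigammaQuarter (freq a ((Bo : ℤ) + 1)) - Real.log π) / 2 - 1 / (8 * ((Bo : ℝ) + 1)) - a * (1 + weilArchDensity (2 * a)) / (π ^ 2 * ((Bo : ℝ) + 1) ^ 2)) - π / 4 - a * (1 + weilArchDensity (2 * a)) / π ^ 2 * Real.sqrt (8 / Bo) - (∑ k ∈ weilPrimeIndex a, (Λ k : ℝ) / Real.sqrt k * (2 * Real.cos (π / (⌊2 * a / Real.log k⌋₊ + 2)))) / 2 - (Real.exp (a / 2) - Real.exp (-(a / 2))) ^ 2 * a / (π ^ 2 * Bo))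
    (hd0o : 0 < d0o ∧ d0o ≤ ((reDigammaQuarter (freq a ((B4o : ℤ) + 1)) - Real.log π) / 2 - 1 / (8 * ((B4o : ℝ) + 1)) - a * (1 + weilArchDensity (2 * a)) / (π ^ 2 * ((B4o : ℝ) + 1) ^ 2)) - π / 4 - a * (1 + weilArchDensity (2 * a)) / π ^ 2 * Real.sqrt (8 / Bo) - (∑ k ∈ weilPrimeIndex a, (Λ k : ℝ) / Real.sqrt k * (2 * Real.cos (π / (⌊2 * a / Real.log k⌋₊ + 2)))) / 2 - (Real.exp (a / 2) - Real.exp (-(a / 2))) ^ 2 * a / (π ^ 2 * Bo))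
    (hwo : ∀ l, Bo ≤ l → l < B3o → 0 < wo l ∧ wo l ≤ ((reDigammaQuarter (freq a ((l : ℤ) + 1)) - Real.log π) / 2 - 1 / (8 * ((l : ℝ) + 1)) - a * (1 + weilArchDensity (2 * a)) / (π ^ 2 * ((l : ℝ) + 1) ^ 2) - (π / 2 - Real.arctan (Real.sqrt Bo / Real.sqrt ((l : ℝ) + 1))) / 2 - a * (1 + weilArchDensity (2 * a)) / π ^ 2 * Real.sqrt (8 / Bo) - (∑ k ∈ weilPrimeIndex a, (Λ k : ℝ) / Real.sqrt k * (2 * Real.cos (π / (⌊2 * a / Real.log k⌋₊ + 2)))) / 2 - (Real.exp (a / 2) - Real.exp (-(a / 2))) ^ 2 * a / (π ^ 2 * Bo)))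
    (hwmo : ∀ l, B3o ≤ l → l < B4o → 0 < wmo l ∧ wmo l ≤ ((reDigammaQuarter (freq a ((l : ℤ) + 1)) - Real.log π) / 2 - 1 / (8 * ((l : ℝ) + 1)) - a * (1 + weilArchDensity (2 * a)) / (π ^ 2 * ((l : ℝ) + 1) ^ 2) - (π / 2 - Real.arctan (Real.sqrt Bo / Real.sqrt ((l : ℝ) + 1))) / 2 - a * (1 + weilArchDensity (2 * a)) / π ^ 2 * Real.sqrt (8 / Bo) - (∑ k ∈ weilPrimeIndex a, (Λ k : ℝ) / Real.sqrt k * (2 * Real.cos (π / (⌊2 * a / Real.log k⌋₊ + 2)))) / 2 - (Real.exp (a / 2) - Real.exp (-(a / 2))) ^ 2 * a / (π ^ 2 * Bo)))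
    (Umido : Matrix (Fin Bo) (Fin Bo) ℝ)
    (hUmido : ∀ d : ℕ → ℝ, (∀ l, B3o ≤ l → l < B4o → 0 < wmo l ∧ wmo l ≤ d l) → ∀ x : Fin Bo → ℝ,
      ∑ l ∈ Finset.Ico B3o B4o, (∑ k : Fin Bo, ((gramCoeff a (((k : ℕ) : ℤ) + 1) ((l : ℤ) + 1) - gramCoeff a (((k : ℕ) : ℤ) + 1) (-((l : ℤ) + 1))) / 2) * x k) ^ 2 / d l
        ≤ x ⬝ᵥ Umido *ᵥ x)
    (U2o : Matrix (Fin Bo) (Fin Bo) ℝ)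
    (hU2o : ∀ d : ℕ → ℝ, (∀ l, B4o ≤ l → d0o ≤ d l) → ∀ (N : ℕ) (x : Fin Bo → ℝ),
      ∑ l ∈ Finset.Ico B4o N, (∑ k : Fin Bo, ((gramCoeff a (((k : ℕ) : ℤ) + 1) ((l : ℤ) + 1) - gramCoeff a (((k : ℕ) : ℤ) + 1) (-((l : ℤ) + 1))) / 2) * x k) ^ 2 / d l
        ≤ x ⬝ᵥ U2o *ᵥ x)
    (hSo : ∀ x : Fin Bo → ℝ, 0 ≤ ∑ k, ∑ k', x k * x k' *
      (((gramCoeff a (((k : ℕ) : ℤ) + 1) (((k' : ℕ) : ℤ) + 1) - gramCoeff a (((k : ℕ) : ℤ) + 1) (-(((k' : ℕ) : ℤ) + 1))) / 2)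
        - (∑ l ∈ Finset.Ico Bo B3o, ((gramCoeff a (((k : ℕ) : ℤ) + 1) ((l : ℤ) + 1) - gramCoeff a (((k : ℕ) : ℤ) + 1) (-((l : ℤ) + 1))) / 2) * ((gramCoeff a (((k' : ℕ) : ℤ) + 1) ((l : ℤ) + 1) - gramCoeff a (((k' : ℕ) : ℤ) + 1) (-((l : ℤ) + 1))) / 2) / wo l)
        - Umido k k' - U2o k k')) :
    WeilPositivityOn a := by
  have hE0 : 0 < weilArchDensity (2 * a) := weilArchDensity_pos (by positivity)
  have hC : 0 ≤ a * (1 + weilArchDensity (2 * a)) := by positivity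
  -- the sector kernels and far diagonals as functions
  set Mev : ℕ → ℕ → ℝ := fun i j ↦ (if i = 0 then gramCoeff a 0 j else if j = 0 then gramCoeff a i 0 else (gramCoeff a i j + gramCoeff a i (-(j : ℤ))) / 2) with hMev
  set Mod : ℕ → ℕ → ℝ := fun k l ↦ ((gramCoeff a ((k : ℤ) + 1) ((l : ℤ) + 1) - gramCoeff a ((k : ℤ) + 1) (-((l : ℤ) + 1))) / 2) with hMod
  set dev : ℕ → ℝ := fun m ↦ ((reDigammaQuarter (freq a m) - Real.log π) / 2 - a * (1 + weilArchDensity (2 * a)) / (π ^ 2 * m ^ 2) - 1 / (8 * m) - a * (1 + weilArchDensity (2 * a)) / π ^ 2 * Real.sqrt (8 / ((Be - 1 : ℕ) : ℝ)) - (∑ k ∈ weilPrimeIndex a, (Λ k : ℝ) / Real.sqrt k * (2 * Real.cos (π / (⌊2 * a / Real.log k⌋₊ + 2)))) / 2) with hdev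
  set dod : ℕ → ℝ := fun l ↦ ((reDigammaQuarter (freq a ((l : ℤ) + 1)) - Real.log π) / 2 - 1 / (8 * ((l : ℝ) + 1)) - a * (1 + weilArchDensity (2 * a)) / (π ^ 2 * ((l : ℝ) + 1) ^ 2) - (π / 2 - Real.arctan (Real.sqrt Bo / Real.sqrt ((l : ℝ) + 1))) / 2 - a * (1 + weilArchDensity (2 * a)) / π ^ 2 * Real.sqrt (8 / Bo) - (∑ k ∈ weilPrimeIndex a, (Λ k : ℝ) / Real.sqrt k * (2 * Real.cos (π / (⌊2 * a / Real.log k⌋₊ + 2)))) / 2 - (Real.exp (a / 2) - Real.exp (-(a / 2))) ^ 2 * a / (π ^ 2 * Bo)) with hdod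
  refine weilPositivityOn_of_sector_kernels_nonneg ha (gramCoeff a) (weilWindowSesq_chi ha) (gramCoeff_neg_neg a)
    ?_ ?_
  · -- EVEN sector
    intro K y
    have hB3e1 : 1 ≤ B3e := by omega
    have hd : ∀ m, Be ≤ m → 0 < dev m := fun m hm ↦ by
      simp only [hdev]
      exact even_dhat_pos_of_pos_at ha hBe h0e m hm
    have hB4e1 : 1 ≤ B4e := by omega
    have hdmono : ∀ m, B4e ≤ m → d0e ≤ dev m := fun m hm ↦ by
      simp only [hdev]
      have h := even_dhat_core_mono ha hC hB4e1 hm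
      linarith [hd0e.2]
    have hfar : ∀ (N : ℕ) (y : ℕ → ℝ),
        ∑ n ∈ Finset.Ico Be N, dev n * y n ^ 2 ≤ ∑ n ∈ Finset.Ico Be N, ∑ m ∈ Finset.Ico Be N, y n * Mev n m * y m :=
      fun N y ↦ by
        simp only [hdev, hMev]
        exact gramCoeff_even_far_ge_diag ha hBe N y
    have hU1 : ∀ x : Fin Be → ℝ,
        ∑ m ∈ Finset.Ico Be B3e, (∑ i : Fin Be, Mev i m * x i) ^ 2 / dev m
          ≤ x ⬝ᵥ (Matrix.of fun i j : Fin Be ↦ ∑ m ∈ Finset.Ico Be B3e, Mev i m * Mev j m / we m) *ᵥ x :=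
      fun x ↦ columns_majorant (Finset.Ico Be B3e) (fun m i ↦ Mev i m) dev we
        (fun m hm ↦ by
          have hm := Finset.mem_Ico.mp hm
          have h := hwe m hm.1 hm.2
          simp only [hdev]
          exact h) x
    have hmid : ∀ x : Fin Be → ℝ,
        ∑ m ∈ Finset.Ico B3e B4e, (∑ i : Fin Be, Mev i m * x i) ^ 2 / dev m ≤ x ⬝ᵥ Umide *ᵥ x := fun x ↦ by
      have h := hUmide dev (fun m hm hm' ↦ by
        have h := hwme m hm hm'
        simp only [hdev]
        exact h) x
      simp only [hMev, hdev] at h ⊢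
      exact h
    have htail : ∀ (N : ℕ) (x : Fin Be → ℝ),
        ∑ m ∈ Finset.Ico B4e N, (∑ i : Fin Be, Mev i m * x i) ^ 2 / dev m ≤ x ⬝ᵥ U2e *ᵥ x := fun N x ↦ by
      have h := hU2e dev hdmono N x
      simp only [hMev, hdev] at h ⊢
      exact h
    have hU2 : ∀ (N : ℕ) (x : Fin Be → ℝ),
        ∑ m ∈ Finset.Ico B3e N, (∑ i : Fin Be, Mev i m * x i) ^ 2 / dev m ≤ x ⬝ᵥ (Umide + U2e) *ᵥ x := by
      intro N x
      have hnn : ∀ m, B3e ≤ m → 0 ≤ (∑ i : Fin Be, Mev i m * x i) ^ 2 / dev m := fun m hm ↦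
        div_nonneg (sq_nonneg _) (hd m (by omega)).le
      rw [Matrix.add_mulVec, dotProduct_add]
      refine le_trans ?_ (add_le_add (hmid x) (htail N x))
      exact sum_Ico_le_sum_Ico_add_sum_Ico hB34e hnn
    have key := sum_range_mul_mul_nonneg_of_certificate_sum_split Mev
      (fun n m ↦ evenKernel_symm (gramCoeff a) (gramCoeff_comm a) (gramCoeff_neg_neg a) n m)
      Be B3e hBBe dev _ _ hd hfar hU1 hU2 (fun x ↦ by
        refine (hSe x).trans_eq (Finset.sum_congr rfl fun i _ ↦ Finset.sum_congr rfl fun i' _ ↦ ?_)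
        simp only [hMev, Matrix.of_apply, Matrix.add_apply]
        ring) K y
    simpa only [hMev] using key
  · -- ODD sector
    intro K z
    have hB3o : 1 ≤ B3o := by omega
    have hd : ∀ l, Bo ≤ l → 0 < dod l := fun l hl ↦ by
      simp only [hdod]
      exact odd_dhat_atan_pos_of_pos_at ha h0o l hl
    have hdlow : ∀ l, B4o ≤ l → d0o ≤ dod l := fun l hl ↦ by
      simp only [hdod]
      have h := odd_dhat_core_mono ha hC hl
      have hpen := hilbert_atan_penalty_le Bo l
      linarith [hd0o.2]
    have hfar : ∀ (N : ℕ) (z : ℕ → ℝ),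
        ∑ k ∈ Finset.Ico Bo N, dod k * z k ^ 2 ≤ ∑ k ∈ Finset.Ico Bo N, ∑ l ∈ Finset.Ico Bo N, z k * Mod k l * z l :=
      fun N z ↦ by
        simp only [hdod, hMod]
        exact gramCoeff_odd_far_ge_diag_atan ha hBo N z
    have hU1 : ∀ x : Fin Bo → ℝ,
        ∑ l ∈ Finset.Ico Bo B3o, (∑ k : Fin Bo, Mod k l * x k) ^ 2 / dod l
          ≤ x ⬝ᵥ (Matrix.of fun k k' : Fin Bo ↦ ∑ l ∈ Finset.Ico Bo B3o, Mod k l * Mod k' l / wo l) *ᵥ x :=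
      fun x ↦ columns_majorant (Finset.Ico Bo B3o) (fun l k ↦ Mod k l) dod wo
        (fun l hl ↦ by
          have hl := Finset.mem_Ico.mp hl
          have h := hwo l hl.1 hl.2
          simp only [hdod]
          exact h) x
    have hmid : ∀ x : Fin Bo → ℝ,
        ∑ l ∈ Finset.Ico B3o B4o, (∑ k : Fin Bo, Mod k l * x k) ^ 2 / dod l ≤ x ⬝ᵥ Umido *ᵥ x := fun x ↦ by
      have h := hUmido dod (fun l hl hl' ↦ by
        have h := hwmo l hl hl'
        simp only [hdod]
        exact h) x
      simp only [hMod, hdod] at h ⊢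
      exact h
    have htail : ∀ (N : ℕ) (x : Fin Bo → ℝ),
        ∑ l ∈ Finset.Ico B4o N, (∑ k : Fin Bo, Mod k l * x k) ^ 2 / dod l ≤ x ⬝ᵥ U2o *ᵥ x := fun N x ↦ by
      have h := hU2o dod hdlow N x
      simp only [hMod, hdod] at h ⊢
      exact h
    have hU2 : ∀ (N : ℕ) (x : Fin Bo → ℝ),
        ∑ l ∈ Finset.Ico B3o N, (∑ k : Fin Bo, Mod k l * x k) ^ 2 / dod l ≤ x ⬝ᵥ (Umido + U2o) *ᵥ x := by
      intro N x
      have hnn : ∀ l, B3o ≤ l → 0 ≤ (∑ k : Fin Bo, Mod k l * x k) ^ 2 / dod l := fun l hl ↦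
        div_nonneg (sq_nonneg _) (hd l (by omega)).le
      rw [Matrix.add_mulVec, dotProduct_add]
      refine le_trans ?_ (add_le_add (hmid x) (htail N x))
      exact sum_Ico_le_sum_Ico_add_sum_Ico hB34o hnn
    have key := sum_range_mul_mul_nonneg_of_certificate_sum_split Mod
      (fun k l ↦ oddKernel_symm (gramCoeff a) (gramCoeff_comm a) (gramCoeff_neg_neg a) k l)
      Bo B3o hBBo dod _ _ hd hfar hU1 hU2 (fun x ↦ by
        refine (hSo x).trans_eq (Finset.sum_congr rfl fun k _ ↦ Finset.sum_congr rfl fun k' _ ↦ ?_)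
        simp only [hMod, Matrix.of_apply, Matrix.add_apply]
        ring) K z
    simpa only [hMod] using key

end Rung

end Summit.RiemannHypothesis.RiemannHypothesis.Theorems.WeilFormatC

end
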